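import Summits.NavierStokesRegularity.NavierStokesRegularity.Theorems.ExtremiserTransienceTypeIAncientMildTimeAnalytic
import Literature.Analysis.FluidPDE.BarkerPrange2020VorticityAlignmentTypeIHolds
import HarnessLib

/-!
# Route `ExtremiserTransience`, crux `NearExtremalTransiencePerFlow` (stmt-NavierStokesRegularity-26567) —
# LINE g9-β «filament selection» §2h: RUNG R4 «no space–time vacuum pocket» as a theorem

`--supports stmt-NavierStokesRegularity-26567`.  Prover seat ns-net-p2 (g6).  Input A (time analyticity, Prop `TypeIAncientMildTimeAnalytic`
of the crux workfile §2g) is the landed `AxiallyPeriodicLiouville.typeIAncientMildTimeAnalytic` (prover ns-net-p1; also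
`Literature.Analysis.FluidPDE.IsTypeIAncientMild.analyticAt_time`, Lemarié-Rieusset 2016 Thm. 9.12).
* `noVacuumPocket` — the Prop `NoVacuumPocket` (§2h, RUNG R4) VERBATIM: a Type-I ancient mild field vanishing on an open space–time
  box `(τ₁, τ₂) × U` (`U` open non-empty, `τ₁ < τ₂ < 0`) vanishes identically (the author's kernel-checked reduction
  `noVacuumPocket_of_timeAnalytic`, with A discharged: identity theorem in time along each `x ∈ U`, then in space on each slice by
  the landed `IsTypeIAncientMild.analyticOnNhd_slice_univ`).
Bearing on the heart H′: a counterexample necklace cannot be built by surgery from vacuum-separated cells.  HONEST FRAMING: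
Liouville-type facts about hypothetical Type-I ancient fields; nothing about Navier–Stokes regularity or blow-up is proved; H′
and the crux stay OPEN; no summit is proved by a line. [cite: LemarieRieusset2016, Thm. 9.12 (PDF p. 260)]
-/

noncomputable section

open scoped Topology
open MeasureTheory Filter Set Function
open Literature.Analysis Literature.Analysis.FluidPDE

namespace Summit.NavierStokesRegularity.NavierStokesRegularity.Theorems

set_option linter.dupNamespace false

namespace NearExtremalTransiencePerFlow.FilamentSelection

/-- **RUNG R4 `NoVacuumPocket` — no space–time vacuum pocket** (verbatim the Prop of the crux workfile §2h; the author's reduction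
`noVacuumPocket_of_timeAnalytic` with input A discharged): a Type-I ancient mild field vanishing on an open box `(τ₁, τ₂) × U`
(`U` open, non-empty, `τ₁ < τ₂ < 0`) is identically zero — identity theorem in time along each `x ∈ U`
(`AxiallyPeriodicLiouville.typeIAncientMildTimeAnalytic`), then in space on every slice (`IsTypeIAncientMild.analyticOnNhd_slice_univ`).
[cite: LemarieRieusset2016, Thm. 9.12 (PDF p. 260)] -/
theorem noVacuumPocket :
    ∀ (K : ℝ) (W : ℝ → EuclideanSpace ℝ (Fin 3) → EuclideanSpace ℝ (Fin 3)) (U : Set (EuclideanSpace ℝ (Fin 3)))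
      (τ₁ τ₂ : ℝ), Literature.Analysis.FluidPDE.IsTypeIAncientMild K W →
      IsOpen U → U.Nonempty → τ₁ < τ₂ → τ₂ < 0 → (∀ σ ∈ Set.Ioo τ₁ τ₂, ∀ x ∈ U, W σ x = 0) →
      ∀ σ : ℝ, σ < 0 → ∀ x, W σ x = 0 := by
  -- adapted from the crux workfile's `noVacuumPocket_of_timeAnalytic` (planner ns-idea-5 g9, rev 9)
  intro K W U τ₁ τ₂ hW hU hne h12 h2 hvac σ hσ
  -- step 1: along every `x ∈ U` the time signal vanishes for all negative times
  have h1 : ∀ x ∈ U, ∀ σ' : ℝ, σ' < 0 → W σ' x = 0 := by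
    intro x hx σ' hσ'
    have han : AnalyticOnNhd ℝ (fun σ : ℝ => W σ x) (Set.Iio 0) := fun σ hσ0 =>
      AxiallyPeriodicLiouville.typeIAncientMildTimeAnalytic K W hW x σ hσ0
    have hm : (τ₁ + τ₂) / 2 ∈ Set.Iio (0 : ℝ) := by
      simp only [Set.mem_Iio]; linarith
    have hev : (fun σ : ℝ => W σ x) =ᶠ[𝓝 ((τ₁ + τ₂) / 2)] 0 := by
      have hI : Set.Ioo τ₁ τ₂ ∈ 𝓝 ((τ₁ + τ₂) / 2) := Ioo_mem_nhds (by linarith) (by linarith)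
      filter_upwards [hI] with σ'' hσ''
      exact hvac σ'' hσ'' x hx
    exact han.eqOn_zero_of_preconnected_of_eventuallyEq_zero isPreconnected_Iio hm hev hσ'
  -- step 2: the slice at time `σ` vanishes on the open non-empty `U`, hence everywhere
  have hsp : AnalyticOnNhd ℝ (W σ) Set.univ := hW.analyticOnNhd_slice_univ hσ
  obtain ⟨x₀, hx₀⟩ := hne
  have hev2 : W σ =ᶠ[𝓝 x₀] 0 := by
    filter_upwards [hU.mem_nhds hx₀] with x hx
    exact h1 x hx σ hσ
  have hz := hsp.eqOn_zero_of_preconnected_of_eventuallyEq_zero isPreconnected_univ (Set.mem_univ x₀) hev2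
  intro x
  exact hz (Set.mem_univ x)

end NearExtremalTransiencePerFlow.FilamentSelection

end Summit.NavierStokesRegularity.NavierStokesRegularity.Theorems

end
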